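import Literature.NumberTheory.LFunctions.WeilTwoPrimeDeflL2Base
import Literature.NumberTheory.LFunctions.WeilBlockRowsPZ
import HarnessLib

/-!
# Deflated two-prime certificate L2: the factored even inverse agrees with `D`, rows 32–39

`WeilCert.checkDnRow` (even block) for certificate L2, by `decide +kernel`. Pure proof file.
-/

noncomputable section

namespace Literature.NumberTheory.LFunctions

set_option maxHeartbeats 0 in
/-- Row 32 of `DnE/LsE` is row 32 of the even `D` (certificate L2). [folklore] -/
theorem checkDnRow0_32_weilCertDeflL2 : weilCertDeflL2Base.checkDnRow weilCertDeflL2DnE weilCertDeflL2LsE 0 32 = true := by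
  decide +kernel

set_option maxHeartbeats 0 in
/-- Row 33 of `DnE/LsE` is row 33 of the even `D` (certificate L2). [folklore] -/
theorem checkDnRow0_33_weilCertDeflL2 : weilCertDeflL2Base.checkDnRow weilCertDeflL2DnE weilCertDeflL2LsE 0 33 = true := by
  decide +kernel

set_option maxHeartbeats 0 in
/-- Row 34 of `DnE/LsE` is row 34 of the even `D` (certificate L2). [folklore] -/
theorem checkDnRow0_34_weilCertDeflL2 : weilCertDeflL2Base.checkDnRow weilCertDeflL2DnE weilCertDeflL2LsE 0 34 = true := by
  decide +kernel

set_option maxHeartbeats 0 in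
/-- Row 35 of `DnE/LsE` is row 35 of the even `D` (certificate L2). [folklore] -/
theorem checkDnRow0_35_weilCertDeflL2 : weilCertDeflL2Base.checkDnRow weilCertDeflL2DnE weilCertDeflL2LsE 0 35 = true := by
  decide +kernel

set_option maxHeartbeats 0 in
/-- Row 36 of `DnE/LsE` is row 36 of the even `D` (certificate L2). [folklore] -/
theorem checkDnRow0_36_weilCertDeflL2 : weilCertDeflL2Base.checkDnRow weilCertDeflL2DnE weilCertDeflL2LsE 0 36 = true := by
  decide +kernel

set_option maxHeartbeats 0 in
/-- Row 37 of `DnE/LsE` is row 37 of the even `D` (certificate L2). [folklore] -/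
theorem checkDnRow0_37_weilCertDeflL2 : weilCertDeflL2Base.checkDnRow weilCertDeflL2DnE weilCertDeflL2LsE 0 37 = true := by
  decide +kernel

set_option maxHeartbeats 0 in
/-- Row 38 of `DnE/LsE` is row 38 of the even `D` (certificate L2). [folklore] -/
theorem checkDnRow0_38_weilCertDeflL2 : weilCertDeflL2Base.checkDnRow weilCertDeflL2DnE weilCertDeflL2LsE 0 38 = true := by
  decide +kernel

set_option maxHeartbeats 0 in
/-- Row 39 of `DnE/LsE` is row 39 of the even `D` (certificate L2). [folklore] -/
theorem checkDnRow0_39_weilCertDeflL2 : weilCertDeflL2Base.checkDnRow weilCertDeflL2DnE weilCertDeflL2LsE 0 39 = true := by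
  decide +kernel


end Literature.NumberTheory.LFunctions
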